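import Mathlib
import HarnessLib
import Literature.Geometry.DiscreteGeometry.SphericalCodeHullEulerFormula

/-!
# Soft four-rings, endgame groundwork: every facet vertex lies on exactly two sides of the facet

Support file for `SoftFourRings` (route `PricedLinkCensus`, sub-problem `Crystallization`),
endgame step (E0) of the evidence file (§12.8, the corner/slot count at a vertex).  For a finite
set `X` of unit vectors of `ℝ³` with `0 ∈ interior (conv X)`, a facet normal `c` and a tight point
`y` of `c`:

* `card_edgesOfFacet_filter_mem` : exactly two of the hull edges of the facet contain `y`
  (the two sides of the convex polygon at its vertex `y`; via the cyclic enumeration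
  `facetVertex` and `edgesOfFacet_eq_image` of the Literature).
-/

namespace Summit.AtomisticToContinuum.Crystallization.Theorems

open Real RealInnerProductSpace Literature.Geometry.DiscreteGeometry

/-- Predecessor arithmetic modulo `m`: for `j₀ < m`, the index `j₁ = (j₀ + m - 1) % m` satisfies
`(j₁ + 1) % m = j₀`, and it is the only such index `< m`. -/
theorem pred_mod_spec {m j₀ : ℕ} (hj₀ : j₀ < m) :
    ((j₀ + m - 1) % m + 1) % m = j₀ ∧ (j₀ + m - 1) % m < m ∧
      ∀ j, j < m → (j + 1) % m = j₀ → j = (j₀ + m - 1) % m := by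
  have hm : 0 < m := by omega
  refine ⟨?_, Nat.mod_lt _ hm, ?_⟩
  · rcases Nat.eq_zero_or_pos j₀ with rfl | hpos
    · rw [Nat.zero_add, Nat.mod_eq_of_lt (by omega : m - 1 < m), Nat.sub_add_cancel hm,
        Nat.mod_self]
    · rw [show j₀ + m - 1 = (j₀ - 1) + m by omega, Nat.add_mod_right,
        Nat.mod_eq_of_lt (by omega : j₀ - 1 < m), show j₀ - 1 + 1 = j₀ by omega,
        Nat.mod_eq_of_lt hj₀]
  · intro j hj h
    rcases succ_mod_cases hj with ⟨a, b⟩ | ⟨a, b⟩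
    · rw [a] at h
      rw [← h, show j + 1 + m - 1 = j + m by omega, Nat.add_mod_right, Nat.mod_eq_of_lt hj]
    · rw [a] at h
      rw [← h, Nat.zero_add, Nat.mod_eq_of_lt (by omega : m - 1 < m)]
      omega

/-- **Every vertex of a facet lies on exactly two of its sides.** -/
theorem card_edgesOfFacet_filter_mem {X : Finset (EuclideanSpace ℝ (Fin 3))}
    (hX1 : ∀ y ∈ X, ‖y‖ = 1)
    (h0 : (0 : EuclideanSpace ℝ (Fin 3)) ∈
      interior (convexHull ℝ (X : Set (EuclideanSpace ℝ (Fin 3)))))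
    {c : EuclideanSpace ℝ (Fin 3)} (hcF : c ∈ facetNormals X) {y : EuclideanSpace ℝ (Fin 3)}
    (hy : y ∈ tightSet X c) :
    ((edgesOfFacet X c).filter (fun T => y ∈ T)).card = 2 := by
  classical
  have hc := ne_zero_of_mem_facetNormals hX1 hcF
  set m := (facetAngles X c hc).card with hm
  set w := facetVertex X c hc with hw
  have hm3 : 3 ≤ m := by rw [hm, card_facetAngles hX1 hc]; exact three_le_card_tightSet hcF
  have hinj : ∀ a b, a < m → b < m → w a = w b → a = b := fun a b ha hb hab =>
    facetVertex_injOn hc (Finset.mem_coe.2 (Finset.mem_range.2 ha))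
      (Finset.mem_coe.2 (Finset.mem_range.2 hb)) hab
  obtain ⟨j₀, hj₀, hwy'⟩ := exists_facetVertex_eq hX1 hc hy
  have hwy : w j₀ = y := hwy'
  clear hwy'
  obtain ⟨hsucc, hj₁, huniq⟩ := pred_mod_spec hj₀
  set j₁ := (j₀ + m - 1) % m with hj₁def
  -- the two sides at `y`
  set e : ℕ → Finset (EuclideanSpace ℝ (Fin 3)) := fun j => {w j, w ((j + 1) % m)} with he
  have hj01 : j₀ ≠ j₁ := by
    intro h
    -- then `(j₀ + 1) % m = j₀`, impossible for `m ≥ 2`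
    have h' : (j₀ + 1) % m = j₀ := by
      conv_lhs => rw [h]
      exact hsucc
    rcases succ_mod_cases hj₀ with ⟨a, b⟩ | ⟨a, b⟩ <;> rw [a] at h' <;> omega
  have hsucc₀ : (j₀ + 1) % m ≠ j₀ := by
    intro h'
    rcases succ_mod_cases hj₀ with ⟨a, b⟩ | ⟨a, b⟩ <;> rw [a] at h' <;> omega
  have hne : e j₀ ≠ e j₁ := by
    intro h
    have hmem : w ((j₀ + 1) % m) ∈ e j₁ := by
      rw [← h]; exact Finset.mem_insert_of_mem (Finset.mem_singleton_self _)
    rw [he] at hmem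
    simp only [Finset.mem_insert, Finset.mem_singleton] at hmem
    rcases hmem with h1 | h1
    · -- `(j₀+1) % m = j₁`: two steps around the polygon return to `j₀`, so `m ∣ 2`
      have e1 : (j₀ + 1) % m = j₁ := hinj _ _ (Nat.mod_lt _ (by omega)) hj₁ h1
      have e2 := hsucc
      rw [← e1] at e2
      rcases succ_mod_cases hj₀ with ⟨a, b⟩ | ⟨a, b⟩
      · rw [a] at e2
        rcases succ_mod_cases b with ⟨a', b'⟩ | ⟨a', b'⟩ <;> rw [a'] at e2 <;> omega
      · rw [a, Nat.zero_add, Nat.mod_eq_of_lt (by omega : 1 < m)] at e2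
        omega
    · rw [hsucc] at h1
      exact hsucc₀ (hinj _ _ (Nat.mod_lt _ (by omega)) hj₀ h1)
  -- the filter is exactly `{e j₀, e j₁}`
  have hfilter : (edgesOfFacet X c).filter (fun T => y ∈ T) = {e j₀, e j₁} := by
    ext T
    rw [edgesOfFacet_eq_image hX1 h0 hcF, Finset.mem_filter, Finset.mem_image, Finset.mem_insert,
      Finset.mem_singleton]
    constructor
    · rintro ⟨⟨j, hj, rfl⟩, hyT⟩
      rw [Finset.mem_range] at hj
      change y ∈ e j at hyT
      rw [he] at hyT
      simp only [Finset.mem_insert, Finset.mem_singleton] at hyT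
      rcases hyT with h1 | h1
      · left
        have : j = j₀ := hinj _ _ hj hj₀ (h1.symm.trans hwy.symm)
        rw [this]
      · right
        have h2 : (j + 1) % m = j₀ := hinj _ _ (Nat.mod_lt _ (by omega)) hj₀ (by rw [← h1, hwy])
        have := huniq j hj h2
        rw [this]
    · rintro (rfl | rfl)
      · refine ⟨⟨j₀, Finset.mem_range.2 hj₀, rfl⟩, ?_⟩
        rw [he, ← hwy]
        exact Finset.mem_insert_self _ _
      · refine ⟨⟨j₁, Finset.mem_range.2 hj₁, rfl⟩, ?_⟩
        rw [he, ← hwy]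
        simp only [Finset.mem_insert, Finset.mem_singleton]
        right
        rw [hsucc]
  rw [hfilter, Finset.card_pair hne]

end Summit.AtomisticToContinuum.Crystallization.Theorems
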